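import Mathlib

/-!
# The plaquette bias of a topologically frozen chain is its sector occupation seen through the
# sector-conditional means (V1 'inherits' V3 at frozen points)

HONEST FRAMING: exact (Metropolis-corrected) sampling algorithms for lattice gauge theory;
figures of merit are autocorrelation/cost numbers at stated couplings and volumes; no
continuum-physics claim.

Venture `LatticeQCDFlow` (cell pub-lqcd), sub-topic `Scoring`; FANOUT row 11 (`eng-scorerA`,
fitness scorer A), GEN-13.  NEW WORK of the cell (finite real algebra; nothing cited as a tree
fact).

## The reading this file types

Row 14 (eng-flowhmc, INBOX 2026-08-21T15:29:01Z) and gauge BASELINES A28 (vii)–(ix) read a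
`V1:exact-mismatch:plaq` HARD on an exact-by-construction 2-d U(1) arm at β 7 as FROZEN TOPOLOGY:
split the target law by topological sector `Q`, with exact sector weights `π_Q` and exact
sector-conditional plaquette means `P_Q`; a chain whose WITHIN-sector sampling is exact but whose
sector occupation is `p̂_Q ≠ π_Q` (too few tunnellings on the run length) reads the plaquette as
`Σ_Q p̂_Q P_Q` instead of `P = Σ_Q π_Q P_Q`.  Row 11's exact computation
(HOME/eng-scorera/RESCORE-A-fthmc-v04s1.md §3, tools/u1_sector_plaquette_A.py: Z_Q and
P_Q = (1/V)∂_β ln Z_Q on the 16² torus) found `P_Q = P_0(1 − cQ²)` to 1e−3 with `c = 3.2913e−4` at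
β 7 (row 14's semiclassical `2π²/V² = 3.012e−4` is 9.3 % low) and predicted each β-7 arm's offset from
its own occupation to within 0.8σ (b7-gc16-b5-f0: predicted +1.048e−4, observed +1.049(26)e−4 —
its z 4.00 is the sector deficit and nothing else).  The algebra behind that reading, for ANY
finite sector set:

* `sectorBias_eq_sum_sub_mul` — **bias = Σ_Q (p̂_Q − π_Q) P_Q**;
* `sectorBias_eq_sum_sub_mul_sub_const` — the bias is blind to a common shift of the `P_Q`
  (both occupation vectors sum to one): `= Σ_Q (p̂_Q − π_Q)(P_Q − C)` for every `C`;
* `abs_sectorBias_le` — **`|bias| ≤ (max_Q |P_Q − C|) · Σ_Q |p̂_Q − π_Q|`**: however frozen the chain,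
  the plaquette cannot move by more than the spread of the sector-conditional means (at β 7, 16²:
  `P_0 − P_3 = 2.7e−3`) times the ℓ¹ occupation error;
* `sectorBias_of_quadratic` — under the (exact to 1e−3) quadratic law `P_Q = P_0 − a·Q²`:
  **bias = a·(⟨Q²⟩_π − ⟨Q²⟩_p̂)** — the V1 plaquette offset IS the V3/χ_t deficit, scaled by `a = c·P_0`;
  `sectorBias_pos_of_deficit` — `a > 0` and a `⟨Q²⟩` DEFICIT ⇒ the frozen chain reads the plaquette
  HIGH (and an excess reads LOW: row 14's b7-gc16-b7-f0, ⟨Q²⟩ 1.348 > 1.006, z −2.6);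
* record numbers (`sectorBias_record`): `a = 3.0472e−4`, `⟨Q²⟩_π = 1.00641`, `⟨Q²⟩_p̂ = 0.66251`
  (b7-gc16-b5-f0) ⇒ `1.047e−4 < bias < 1.049e−4` (observed +1.049e−4 ± 0.26e−4).

What is NOT here: the values `π_Q`, `P_Q`, `c` themselves (quadrature of Bessel-type integrals —
numerics of record, not kernel facts), and the statement that within-sector sampling of a given
engine IS exact (that is what the residual `observed − predicted` measures).  The lemma is the
reason the docket item L2-A16 proposes to PRINT `P̂ − Σ_Q p̂_Q P_Q` beside the raw V1 z at frozen
points, and the reason the HARD itself stays: a chain with `p̂ ≠ π` is not sampling the target on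
that run length, whatever its within-sector quality.
-/

namespace Summit.Ventures.LatticeQCDFlow.Scoring

open Finset
open scoped BigOperators

variable {ι : Type*} [Fintype ι]

/-- The mean of sector-conditional values `P` under a sector occupation vector `p`:
`Σ_Q p_Q P_Q` (the plaquette a chain with occupation `p` reads when its within-sector sampling
is exact). -/
noncomputable def sectorMix (p P : ι → ℝ) : ℝ := ∑ k, p k * P k

/-- The sector-occupation bias: chain occupation `p` versus exact weights `w`,
`sectorMix p P − sectorMix w P`. -/
noncomputable def sectorBias (p w P : ι → ℝ) : ℝ := sectorMix p P - sectorMix w P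

/-- **bias = Σ_Q (p̂_Q − π_Q) P_Q.** -/
theorem sectorBias_eq_sum_sub_mul (p w P : ι → ℝ) :
    sectorBias p w P = ∑ k, (p k - w k) * P k := by
  unfold sectorBias sectorMix
  rw [← Finset.sum_sub_distrib]
  exact Finset.sum_congr rfl fun k _ => by ring

/-- **Shift invariance:** when both occupation vectors sum to one, the bias does not see a common
shift of the sector-conditional means: `bias = Σ_Q (p̂_Q − π_Q)(P_Q − C)` for every `C`. -/
theorem sectorBias_eq_sum_sub_mul_sub_const (p w P : ι → ℝ) (hp : ∑ k, p k = 1)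
    (hw : ∑ k, w k = 1) (C : ℝ) :
    sectorBias p w P = ∑ k, (p k - w k) * (P k - C) := by
  rw [sectorBias_eq_sum_sub_mul]
  have h0 : ∑ k, (p k - w k) = 0 := by rw [Finset.sum_sub_distrib, hp, hw, sub_self]
  have : ∑ k, (p k - w k) * (P k - C) = ∑ k, (p k - w k) * P k - C * ∑ k, (p k - w k) := by
    rw [Finset.mul_sum, ← Finset.sum_sub_distrib]
    exact Finset.sum_congr rfl fun k _ => by ring
  rw [this, h0, mul_zero, sub_zero]

/-- **`|bias| ≤ (max_Q |P_Q − C|) · Σ_Q |p̂_Q − π_Q|`** (Hölder ℓ∞ × ℓ¹): a bound `M` on the spread of the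
sector-conditional means around any centre `C` bounds the plaquette offset by `M` times the ℓ¹
error of the sector occupation — at β 7, 16² the four populated sectors span only
`P_0 − P_3 = 2.7e−3`, so no occupation error whatsoever moves the plaquette by more than that. -/
theorem abs_sectorBias_le (p w P : ι → ℝ) (hp : ∑ k, p k = 1) (hw : ∑ k, w k = 1) (C M : ℝ)
    (hM : ∀ k, |P k - C| ≤ M) : |sectorBias p w P| ≤ M * ∑ k, |p k - w k| := by
  rw [sectorBias_eq_sum_sub_mul_sub_const p w P hp hw C]
  calc |∑ k, (p k - w k) * (P k - C)| ≤ ∑ k, |(p k - w k) * (P k - C)| :=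
        Finset.abs_sum_le_sum_abs _ _
    _ = ∑ k, |p k - w k| * |P k - C| := Finset.sum_congr rfl fun k _ => abs_mul _ _
    _ ≤ ∑ k, |p k - w k| * M :=
        Finset.sum_le_sum fun k _ => mul_le_mul_of_nonneg_left (hM k) (abs_nonneg _)
    _ = M * ∑ k, |p k - w k| := by rw [← Finset.sum_mul, mul_comm]

/-- The second moment of the charge under an occupation vector, `⟨Q²⟩_p = Σ_Q p_Q Q²`. -/
noncomputable def chargeSqMoment (p : ι → ℝ) (q : ι → ℝ) : ℝ := ∑ k, p k * q k ^ 2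

/-- **Quadratic law ⇒ bias = a·(⟨Q²⟩_π − ⟨Q²⟩_p̂).**  If the sector-conditional means follow
`P_Q = P₀ − a·Q²` (row 11's exact table: true to 1e−3 out to |Q| = 4 at β 5 and 7 on 16², with
`a = c·P_0`, `c = 3.2913e−4` at β 7), the plaquette offset of a chain with exact within-sector
sampling is `a` times its topological-susceptibility DEFICIT — the V1 plaquette test and the
V3 / χ_t tests are then one measurement, not two. -/
theorem sectorBias_of_quadratic (p w : ι → ℝ) (q : ι → ℝ) (P₀ a : ℝ) (hp : ∑ k, p k = 1)
    (hw : ∑ k, w k = 1) :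
    sectorBias p w (fun k => P₀ - a * q k ^ 2) = a * (chargeSqMoment w q - chargeSqMoment p q) := by
  rw [sectorBias_eq_sum_sub_mul_sub_const p w _ hp hw P₀]
  unfold chargeSqMoment
  rw [mul_sub, Finset.mul_sum, Finset.mul_sum, ← Finset.sum_sub_distrib]
  exact Finset.sum_congr rfl fun k _ => by ring

/-- **Sign:** with `a > 0` (larger |Q| ⇒ smaller plaquette) a chain with a `⟨Q²⟩` DEFICIT reads the
plaquette HIGH; by symmetry an excess reads it LOW (row 14's b7-gc16-b7-f0: ⟨Q²⟩ 1.348 vs 1.006,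
plaquette z −2.6). -/
theorem sectorBias_pos_of_deficit (p w : ι → ℝ) (q : ι → ℝ) (P₀ a : ℝ) (hp : ∑ k, p k = 1)
    (hw : ∑ k, w k = 1) (ha : 0 < a) (hdef : chargeSqMoment p q < chargeSqMoment w q) :
    0 < sectorBias p w (fun k => P₀ - a * q k ^ 2) := by
  rw [sectorBias_of_quadratic p w q P₀ a hp hw]
  exact mul_pos ha (sub_pos.mpr hdef)

/-- Record numbers (RESCORE-A-fthmc-v04s1.md §3; 2-d U(1), β 7, 16², row 14's arm b7-gc16-b5-f0):
`a = c·P_0 = 3.0472e−4`, `⟨Q²⟩_exact = 1.00641`, `⟨Q²⟩_chain = 0.66251` ⇒ the predicted offset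
`a·Δ⟨Q²⟩` lies in `(1.047e−4, 1.049e−4)`; observed `+1.049e−4 ± 0.26e−4` (frozen scorer A z 4.00),
i.e. the residual after the sector correction is `0.0σ`. -/
theorem sectorBias_record :
    (1.047e-4 : ℝ) < 3.0472e-4 * (1.00641 - 0.66251) ∧
      (3.0472e-4 : ℝ) * (1.00641 - 0.66251) < 1.049e-4 := by
  constructor <;> norm_num

end Summit.Ventures.LatticeQCDFlow.Scoring
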